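import Summits.BirchSwinnertonDyer.BirchSwinnertonDyer.Theses.PlecticLegs
import Summits.BirchSwinnertonDyer.BirchSwinnertonDyer.Theses.Squeeze

/-!
# Strategy census r1 — Lean evidence for crux `PlecticRankUB` (stmt-BirchSwinnertonDyer-17519)

Seat `planner-cstrat-stmt-BirchSwinnertonDyer-17519-r1-0` (REDIRECT STRATEGIST, second opinion),
2026-08-17. Companion of `Cruxes/PlecticRankUB/STRATEGY-CENSUS-r1.md`.

Crux (route `PlecticLegs`, #3, verbatim):
`PlecticRankUB := ∀ F [NumberField F] [IsTotallyReal F] (V : WeierstrassCurve F) [V.IsElliptic],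
  2 ≤ finrank ℚ F → V.analyticRank = finrank ℚ F → V.mordellWeilRank ≤ finrank ℚ F`.

Contents (all sorry-free):

* §1 STRENGTH — the theorem that places the crux for the tribunal. With the route's OTHER items
  (`TwistSupply`, `ArtinBaseChange`, `KatoDescent`, `RankLeOne`) the crux PROVES the ledger item
  `Squeeze.SqueezeUB` = stmt-BirchSwinnertonDyer-0145 (`rank E(ℚ) ≤ r_an(E)` for EVERY elliptic
  curve over `ℚ`, the upper-bound half of the summit): `squeezeUB_of_plecticLegsItems`.
  Conversely `SqueezeUB + ArtinBaseChange + KatoDescent` prove the crux at every instance the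
  route's deciding theorem `closes` consumes (`OnSilentBaseChangeUB`,
  `onSilentBaseChangeUB_of_squeezeUB`), and modulo the four other items the two are EQUIVALENT
  (`squeezeUB_iff_onSilentBaseChangeUB`). Re-glue previews: `closes_of_onSilentBaseChangeUB`,
  `closes_with_squeezeUB` (the route's `closes` with the crux replaced by the weaker item / by 0145).
* §2 DECOMPOSITION — the family split typed on the crux's own variables (`FamilyUB`, `OffFamilyUB`,
  `plecticRankUB_iff_split`), and the reduction of the family piece to `OnSilentBaseChangeUB` modulo
  the formal transport statement `Transport` (`familyUB_of_onSilentBaseChangeUB`).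
* §3 STRENGTHEN — `UBTotallyReal` (all analytic ranks over totally real fields) and
  `UBAbelianBaseChange` (all abelian base changes, silent or not, every regime), each implying the
  relevant statement modulo the junk-branch hygiene `JunkBranch`.
* §4 NEGATION — the shape of a counterexample (`not_plecticRankUB_iff`).
-/

noncomputable section

open scoped Classical

namespace Summit.BirchSwinnertonDyer.BirchSwinnertonDyer.Cruxes.PlecticRankUB.CensusR1

open Summit.BirchSwinnertonDyer.BirchSwinnertonDyer.Theses.PlecticLegs
open Summit.BirchSwinnertonDyer.BirchSwinnertonDyer.Theses.Squeeze (SqueezeUB)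

/-! ## §0 Vocabulary shared with the route file -/

/-- `Silent W m H`: every non-trivial Dirichlet character mod `m` trivial on `H` (i.e. every
non-trivial character of `Gal(F/ℚ)`, `F = ℚ(ζ_m)^H`) has `L(W,χ,1) ≠ 0` — VERBATIM the common
hypothesis of the route items `ArtinBaseChange` and `KatoDescent` and the output of `TwistSupply`.
[folklore] -/
def Silent (W : WeierstrassCurve ℚ) (m : ℕ) [NeZero m]
    (H : Subgroup (CyclotomicField m ℚ ≃ₐ[ℚ] CyclotomicField m ℚ)) : Prop :=
  ∀ χ : DirichletCharacter ℂ m, (∀ σ ∈ H, ∀ a : ℕ,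
      (∀ z : CyclotomicField m ℚ, z ^ m = 1 → σ z = z ^ a) → χ (a : ZMod m) = 1) → χ ≠ 1 →
      ∃ L : ℂ → ℂ, Differentiable ℂ L ∧
        (∀ s : ℂ, 2 < s.re → L s = LSeries (fun n ↦ χ n * ((W.LFunction n : ℤ) : ℂ)) s) ∧ L 1 ≠ 0

/-- **The crux at exactly the instances `closes` consumes**: silent abelian totally real base
changes `W_F`, `F = ℚ(ζ_m)^H`, in the plectic regime `r_an(W_F) = [F:ℚ] ≥ 2`. [folklore] -/
def OnSilentBaseChangeUB : Prop :=
  ∀ (W : WeierstrassCurve ℚ) [W.IsElliptic] (m : ℕ) [NeZero m]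
    (H : Subgroup (CyclotomicField m ℚ ≃ₐ[ℚ] CyclotomicField m ℚ)), Silent W m H →
    (letI : NumberField ↥(IntermediateField.fixedField H) := NumberField.mk
     NumberField.IsTotallyReal ↥(IntermediateField.fixedField H) →
     2 ≤ Module.finrank ℚ ↥(IntermediateField.fixedField H) →
     (W.baseChange ↥(IntermediateField.fixedField H)).analyticRank =
        Module.finrank ℚ ↥(IntermediateField.fixedField H) →
     (W.baseChange ↥(IntermediateField.fixedField H)).mordellWeilRank ≤
        Module.finrank ℚ ↥(IntermediateField.fixedField H))

/-! ## §1 Strength: crux + the route's other items ⊢ stmt-0145, and back on the family -/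

/-- The crux trivially gives its restriction to the route's family. [folklore] -/
theorem onSilentBaseChangeUB_of_plecticRankUB (h : PlecticRankUB) : OnSilentBaseChangeUB := by
  intro W hW m hm H _hS
  haveI := hW
  haveI := hm
  letI : NumberField ↥(IntermediateField.fixedField H) := NumberField.mk
  intro hreal hdeg hran
  haveI : NumberField.IsTotallyReal ↥(IntermediateField.fixedField H) := hreal
  haveI : (W.baseChange ↥(IntermediateField.fixedField H)).IsElliptic :=
    inferInstanceAs (W.map (algebraMap ℚ ↥(IntermediateField.fixedField H))).IsElliptic
  exact h ↥(IntermediateField.fixedField H) (W.baseChange _) hdeg hran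

/-- **stmt-0145 ⊢ the family piece.** `SqueezeUB` (`rank ≤ r_an` over `ℚ`) with the two KNOWN
supports gives the crux at every instance `closes` uses:
`rank W_F(F) = rank W(ℚ) ≤ r_an(W) = r_an(W_F) = [F:ℚ]`. Neither `IsTotallyReal` nor `2 ≤ d` is
used. [folklore] -/
theorem onSilentBaseChangeUB_of_squeezeUB (hQ : SqueezeUB) (hA : ArtinBaseChange)
    (hK : KatoDescent) : OnSilentBaseChangeUB := by
  intro W hW m hm H hS
  haveI := hW
  haveI := hm
  letI : NumberField ↥(IntermediateField.fixedField H) := NumberField.mk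
  intro _hreal _hdeg hran
  have hran' := hA W m H hS
  have hdesc := hK W m H hS
  have hq := hQ W
  omega

/-- **The family piece + the route's other items ⊢ stmt-0145** (all of it: `r_an ≤ 1` by
`RankLeOne`, `r_an ≥ 2` by a silent field from `TwistSupply`, Artin formalism, the family piece,
Kato descent). [folklore] -/
theorem squeezeUB_of_onSilentBaseChangeUB (h : OnSilentBaseChangeUB) (hT : TwistSupply)
    (hA : ArtinBaseChange) (hK : KatoDescent) (hR1 : RankLeOne) : SqueezeUB := by
  intro W hW
  haveI := hW
  by_cases h1 : W.analyticRank ≤ 1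
  · exact (hR1 W h1).ge
  · have h2 : 2 ≤ W.analyticRank := by omega
    obtain ⟨m, instm, H, hreal, hdeg, hchi⟩ := hT W h2
    haveI := instm
    letI : NumberField ↥(IntermediateField.fixedField H) := NumberField.mk
    have hran := hA W m H hchi
    have hdesc := hK W m H hchi
    have hdegF : 2 ≤ Module.finrank ℚ ↥(IntermediateField.fixedField H) := by omega
    have hranF : (W.baseChange ↥(IntermediateField.fixedField H)).analyticRank =
        Module.finrank ℚ ↥(IntermediateField.fixedField H) := by omega
    have hub := h W m H hchi hreal hdegF hranF
    omega

/-- **EQUIVALENCE modulo the route's other items**: on the ledger, the part of crux 17519 the route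
uses and item 0145 are the same obligation. [folklore] -/
theorem squeezeUB_iff_onSilentBaseChangeUB (hT : TwistSupply) (hA : ArtinBaseChange)
    (hK : KatoDescent) (hR1 : RankLeOne) : SqueezeUB ↔ OnSilentBaseChangeUB :=
  ⟨fun hQ => onSilentBaseChangeUB_of_squeezeUB hQ hA hK,
   fun h => squeezeUB_of_onSilentBaseChangeUB h hT hA hK hR1⟩

/-- **STRENGTH THEOREM (for the tribunal).** The route's items with crux 17519 PROVE stmt-0145
(`Squeeze.SqueezeUB`, shared by routes Squeeze / HigherGrossZagier / LeadingTerm): any proof of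
`PlecticRankUB` is, given the route's own `TwistSupply` and the three known supports, a proof of
`rank E(ℚ) ≤ ord_{s=1} L(E,s)` for every elliptic curve over `ℚ` — the upper-bound half of the
summit in every analytic rank. [folklore] -/
theorem squeezeUB_of_plecticLegsItems (hUB : PlecticRankUB) (hT : TwistSupply)
    (hA : ArtinBaseChange) (hK : KatoDescent) (hR1 : RankLeOne) : SqueezeUB :=
  squeezeUB_of_onSilentBaseChangeUB (onSilentBaseChangeUB_of_plecticRankUB hUB) hT hA hK hR1

/-- Re-glue preview 1: the route's deciding theorem with the crux REPLACED by its family piece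
(same proof as `Theses.PlecticLegs.closes`). [folklore] -/
theorem closes_of_onSilentBaseChangeUB (hLB : PlecticPointsLB) (hUB : OnSilentBaseChangeUB)
    (hT : TwistSupply) (hA : ArtinBaseChange) (hK : KatoDescent) (hR1 : RankLeOne) :
    _root_.BirchSwinnertonDyer := by
  intro W hW
  haveI := hW
  by_cases h1 : W.analyticRank ≤ 1
  · exact hR1 W h1
  · have h2 : 2 ≤ W.analyticRank := by omega
    obtain ⟨m, instm, H, hreal, hdeg, hchi⟩ := hT W h2
    haveI := instm
    letI : NumberField ↥(IntermediateField.fixedField H) := NumberField.mk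
    haveI : NumberField.IsTotallyReal ↥(IntermediateField.fixedField H) := hreal
    haveI : (W.baseChange ↥(IntermediateField.fixedField H)).IsElliptic :=
      inferInstanceAs (W.map (algebraMap ℚ ↥(IntermediateField.fixedField H))).IsElliptic
    have hran : (W.baseChange ↥(IntermediateField.fixedField H)).analyticRank = W.analyticRank :=
      hA W m H hchi
    have hdegF : 2 ≤ Module.finrank ℚ ↥(IntermediateField.fixedField H) := by omega
    have hranF : (W.baseChange ↥(IntermediateField.fixedField H)).analyticRank =
        Module.finrank ℚ ↥(IntermediateField.fixedField H) := by omega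
    have hlb := hLB ↥(IntermediateField.fixedField H) (W.baseChange _) hdegF hranF
    have hub := hUB W m H hchi hreal hdegF hranF
    have hdesc := hK W m H hchi
    omega

/-- Re-glue preview 2: the route closes BSD from `PlecticPointsLB`, stmt-0145 and its four other
items — WITHOUT crux 17519. [folklore] -/
theorem closes_with_squeezeUB (hLB : PlecticPointsLB) (hQ : SqueezeUB) (hT : TwistSupply)
    (hA : ArtinBaseChange) (hK : KatoDescent) (hR1 : RankLeOne) : _root_.BirchSwinnertonDyer :=
  closes_of_onSilentBaseChangeUB hLB (onSilentBaseChangeUB_of_squeezeUB hQ hA hK) hT hA hK hR1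

/-! ## §2 Decomposition: the family split, typed on the crux's own variables -/

/-- `(F, V)` lies on the route's family: `F ≅ ℚ(ζ_m)^H` silent for some elliptic `W/ℚ` and `V` is
`W` base-changed along that isomorphism. [folklore] -/
def OnFamily (F : Type) [Field F] [NumberField F] (V : WeierstrassCurve F) : Prop :=
  ∃ (W : WeierstrassCurve ℚ) (_ : W.IsElliptic) (m : ℕ) (_ : NeZero m)
    (H : Subgroup (CyclotomicField m ℚ ≃ₐ[ℚ] CyclotomicField m ℚ))
    (e : ↥(IntermediateField.fixedField H) ≃+* F),
    Silent W m H ∧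
      V = W.map ((e : ↥(IntermediateField.fixedField H) →+* F).comp
        (algebraMap ℚ ↥(IntermediateField.fixedField H)))

/-- Piece 1: the crux ON the family. [folklore] -/
def FamilyUB : Prop :=
  ∀ (F : Type) [Field F] [NumberField F] [NumberField.IsTotallyReal F] (V : WeierstrassCurve F)
    [V.IsElliptic], OnFamily F V → 2 ≤ Module.finrank ℚ F → V.analyticRank = Module.finrank ℚ F →
      V.mordellWeilRank ≤ Module.finrank ℚ F

/-- Piece 2: the crux OFF the family (primitive `V/F`, non-silent or non-abelian `F`, twists…).
[folklore] -/
def OffFamilyUB : Prop :=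
  ∀ (F : Type) [Field F] [NumberField F] [NumberField.IsTotallyReal F] (V : WeierstrassCurve F)
    [V.IsElliptic], ¬ OnFamily F V → 2 ≤ Module.finrank ℚ F →
      V.analyticRank = Module.finrank ℚ F → V.mordellWeilRank ≤ Module.finrank ℚ F

/-- The split is exact (trivial seam, by cases). [folklore] -/
theorem plecticRankUB_iff_split : PlecticRankUB ↔ FamilyUB ∧ OffFamilyUB := by
  constructor
  · intro h
    exact ⟨fun F _ _ _ V _ _ hd hr => h F V hd hr, fun F _ _ _ V _ _ hd hr => h F V hd hr⟩
  · rintro ⟨h₁, h₂⟩ F _ _ _ V _ hd hr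
    by_cases hf : OnFamily F V
    · exact h₁ F V hf hd hr
    · exact h₂ F V hf hd hr

/-- The formal transport statement (true; Mathlib plumbing, not in tree): degree, total reality,
analytic rank and Mordell–Weil rank are invariant under a field isomorphism. Isolated as a
hypothesis so that the reduction below is kernel-checked without it. [folklore] -/
def Transport : Prop :=
  ∀ (F F' : Type) [Field F] [NumberField F] [Field F'] [NumberField F'] (e : F ≃+* F'),
    Module.finrank ℚ F = Module.finrank ℚ F' ∧
    (NumberField.IsTotallyReal F' → NumberField.IsTotallyReal F) ∧
    ∀ V : WeierstrassCurve F,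
      (V.map (e : F →+* F')).analyticRank = V.analyticRank ∧
      (V.map (e : F →+* F')).mordellWeilRank = V.mordellWeilRank

/-- **Piece 1 is the ledger item 0145 in costume**: modulo `Transport`, `FamilyUB` follows from
`OnSilentBaseChangeUB` (hence from `SqueezeUB + ArtinBaseChange + KatoDescent`). [folklore] -/
theorem familyUB_of_onSilentBaseChangeUB (hTr : Transport) (h : OnSilentBaseChangeUB) :
    FamilyUB := by
  intro F _ _ hrealF V _ hf hd hr
  obtain ⟨W, hW, m, hm, H, e, hS, hV⟩ := hf
  haveI := hW
  haveI := hm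
  letI : NumberField ↥(IntermediateField.fixedField H) := NumberField.mk
  obtain ⟨hdegEq, hrealT, hV'⟩ := hTr ↥(IntermediateField.fixedField H) F e
  obtain ⟨hanT, hmwT⟩ := hV' (W.baseChange ↥(IntermediateField.fixedField H))
  have hmap : V = (W.baseChange ↥(IntermediateField.fixedField H)).map
      (e : ↥(IntermediateField.fixedField H) →+* F) := by
    rw [hV, WeierstrassCurve.baseChange, WeierstrassCurve.map_map]
  have hreal0 : NumberField.IsTotallyReal ↥(IntermediateField.fixedField H) := hrealT hrealF
  have hdeg0 : 2 ≤ Module.finrank ℚ ↥(IntermediateField.fixedField H) := by omega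
  have hran0 : (W.baseChange ↥(IntermediateField.fixedField H)).analyticRank =
      Module.finrank ℚ ↥(IntermediateField.fixedField H) := by
    rw [← hanT, ← hmap, hr, hdegEq]
  have hub := h W m H hS hreal0 hdeg0 hran0
  rw [hmap, hmwT]
  omega

/-- Hence, modulo `Transport`, the whole crux is `OffFamilyUB` plus item 0145 and the supports:
the ONLY open content the route does not already share with the board is the off-family piece.
[folklore] -/
theorem plecticRankUB_of_offFamily (hTr : Transport) (hQ : SqueezeUB) (hA : ArtinBaseChange)
    (hK : KatoDescent) (hOff : OffFamilyUB) : PlecticRankUB :=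
  plecticRankUB_iff_split.mpr
    ⟨familyUB_of_onSilentBaseChangeUB hTr (onSilentBaseChangeUB_of_squeezeUB hQ hA hK), hOff⟩

/-! ## §3 Strengthenings -/

/-- Junk-branch hygiene (true: without an entire continuation the formal Dirichlet series is the
junk `LSeries`, identically `0` on `Re s ≤ 1`, so `analyticOrderNatAt = 0`; needs a Chebotarev /
Sato–Tate density input to prove). [folklore] -/
def JunkBranch : Prop :=
  ∀ (F : Type) [Field F] [NumberField F] (V : WeierstrassCurve F),
    ¬ V.HasEntireLFunction → V.analyticRank = 0

/-- S⁺_TR: the rank inequality of BSD over totally real fields in EVERY analytic rank (guarded by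
the continuation). [folklore] -/
def UBTotallyReal : Prop :=
  ∀ (F : Type) [Field F] [NumberField F] [NumberField.IsTotallyReal F] (V : WeierstrassCurve F)
    [V.IsElliptic], V.HasEntireLFunction → V.mordellWeilRank ≤ V.analyticRank

/-- S⁺_TR ⊢ crux (modulo the hygiene). [folklore] -/
theorem plecticRankUB_of_UBTotallyReal (hJ : JunkBranch) (h : UBTotallyReal) : PlecticRankUB := by
  intro F _ _ _ V _ hd hr
  by_cases hE : V.HasEntireLFunction
  · have := h F V hE
    omega
  · have := hJ F V hE
    omega

/-- S⁺_AB: the rank inequality for ALL abelian base changes `W_F`, `F = ℚ(ζ_m)^H` (silent or not,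
totally real or not, every regime). Incomparable with the crux; it strengthens the FAMILY piece.
[folklore] -/
def UBAbelianBaseChange : Prop :=
  ∀ (W : WeierstrassCurve ℚ) [W.IsElliptic] (m : ℕ) [NeZero m]
    (H : Subgroup (CyclotomicField m ℚ ≃ₐ[ℚ] CyclotomicField m ℚ)),
    (letI : NumberField ↥(IntermediateField.fixedField H) := NumberField.mk
     (W.baseChange ↥(IntermediateField.fixedField H)).HasEntireLFunction →
     (W.baseChange ↥(IntermediateField.fixedField H)).mordellWeilRank ≤
        (W.baseChange ↥(IntermediateField.fixedField H)).analyticRank)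

/-- S⁺_AB ⊢ the family piece (modulo the hygiene). [folklore] -/
theorem onSilentBaseChangeUB_of_UBAbelianBaseChange (hJ : JunkBranch) (h : UBAbelianBaseChange) :
    OnSilentBaseChangeUB := by
  intro W hW m hm H _hS
  haveI := hW
  haveI := hm
  letI : NumberField ↥(IntermediateField.fixedField H) := NumberField.mk
  intro _hreal hdeg hran
  by_cases hE : (W.baseChange ↥(IntermediateField.fixedField H)).HasEntireLFunction
  · have := h W m H hE
    omega
  · have := hJ ↥(IntermediateField.fixedField H) (W.baseChange _) hE
    omega

/-! ## §4 Negation: shape of a counterexample -/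

/-- `¬ PlecticRankUB` is a counterexample to BSD over a totally real field in the plectic regime:
a certified `r_an(V/F) = [F:ℚ] ≥ 2` with `rank V(F) > [F:ℚ]`. [folklore] -/
theorem not_plecticRankUB_iff :
    ¬ PlecticRankUB ↔ ∃ (F : Type) (_ : Field F) (_ : NumberField F),
      NumberField.IsTotallyReal F ∧ ∃ V : WeierstrassCurve F, V.IsElliptic ∧
      (2 ≤ Module.finrank ℚ F ∧ V.analyticRank = Module.finrank ℚ F ∧
        Module.finrank ℚ F < V.mordellWeilRank) := by
  unfold PlecticRankUB
  push_neg
  rfl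

end Summit.BirchSwinnertonDyer.BirchSwinnertonDyer.Cruxes.PlecticRankUB.CensusR1

end
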